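import Summits.NavierStokesRegularity.NavierStokesRegularity.Theorems.PerpetualPumpThesisLocalExistenceStep
import Summits.NavierStokesRegularity.NavierStokesRegularity.Theorems.PerpetualPumpThesisBilinearOperatorSpace

/-!
# Stub E (`localExistence`) for `PerpetualPump.Thesis`: local existence of `H¹⁰_df`-mild
# solutions with lifespan uniform on `H¹⁰`-balls

Final file of the stub `localExistence` of line `SketchIdeator2` (crux
stmt-NavierStokesRegularity-1832): the standard local existence theory for Tao's averaged
Navier–Stokes equation `∂ₜu = Δu + B̃(u,u)` in `C([0,τ]; H¹⁰_df(ℝ³))` (T. Tao, J. Amer. Math.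
Soc. 29 (2016), arXiv:1402.0290v3, §1.1 after (1.15): "the local existence theory is standard"),
for an arbitrary averaging datum `𝒜`, *given* a bilinear representative `Bop` of `𝒜.form` with
the tame bound `‖Bop(u,v)‖_{H⁹} ≤ K‖u‖_{H¹⁰}‖v‖_{H¹⁰}` (stub B).

Proof: Picard iteration on the lifted level `g = ⟨D⟩¹⁰u ∈ C([0,τ]; L²)` (parts I–III):
`g₀(t) = e^{tΔ}g_a`, `g_{n+1} = Φ(g_n)`; the curves stay continuous, bounded by `M = 2R+1` and
`H¹⁰_df`-valued under `J = ⟨D⟩⁻¹⁰`, consecutive differences halve, so `g_n → g` uniformly; the limit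
is a fixed point of `Φ`, and `u = Jg` satisfies Tao's duality form of the Duhamel identity
(1.15) against every `w ∈ H¹⁰_df`, because `J` and the pairing with `w` commute with the Bochner
integral, `⟨e^{(t-s)Δ}Bop(u,u), w⟩ = ⟨Bop(u,u), e^{(t-s)Δ}w⟩ = 𝒜.form(u,u,e^{(t-s)Δ}w)`. The
lifespan `τ = τ(K,R)` only depends on the radius `R` of the `H¹⁰`-ball of data.

## References

* T. Tao, J. Amer. Math. Soc. 29 (2016), 601–674, arXiv:1402.0290v3, §1.1 (1.15).
-/

noncomputable section

open MeasureTheory Set Filter Topology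
open scoped ENNReal NNReal Interval

set_option linter.dupNamespace false

namespace Summit.NavierStokesRegularity.NavierStokesRegularity.Theorems.PerpetualPumpThesis.E

open Literature.Analysis.FluidPDE Literature.Analysis.FluidPDE.Tao2016
open Literature.Analysis.FunctionSpaces (eFourierSobolevNorm)
open Summit.NavierStokesRegularity.NavierStokesRegularity.Theorems.PerpetualPumpEulerTypeIGlue
  (continuous_heat_apply norm_heat_le)

/-! ### Picard iteration on the lifted level -/

/-- **The lifted Picard iteration converges to a fixed point.** Under the hypotheses of parts
I–III (tame bilinear `Bop`, toolkit `(J, P, L)`, datum `a = J g_a` with `‖g_a‖ ≤ R ≤ M`,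
constants with `R + KM²η ≤ M`, `2KMη ≤ ½`, and the clock bound `η` on `[0, τ]`), there is a
continuous curve `g`, bounded by `M`, with `Jg(t) ∈ H¹⁰_df`, and `g = Φ(g)`. -/
theorem exists_fixedPoint {Bop : L2C → L2C → L2C} {K : ℝ} (hK : 0 ≤ K)
    (hB9 : ∀ u v : L2C, MemH10df u → MemH10df v → eFourierSobolevNorm 9 (Bop u v) ≤
      ENNReal.ofReal K * eFourierSobolevNorm 10 u * eFourierSobolevNorm 10 v)
    (hBrd : ∀ u v : L2C, MemH10df u → MemH10df v → IsReal (Bop u v) ∧ IsFourierDivFree (Bop u v))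
    (hBadd : ∀ u u' v : L2C, MemH10df u → MemH10df u' → MemH10df v →
      Bop (u + u') v = Bop u v + Bop u' v ∧ Bop v (u + u') = Bop v u + Bop v u')
    {J : L2C →L[ℂ] L2C} (hJn : ∀ h : L2C, eFourierSobolevNorm 10 (J h) = ‖h‖ₑ)
    (hJh : ∀ (τ : ℝ) (h : L2C), J (heat τ h) = heat τ (J h))
    {L : L2C → L2C}
    (hLsub : ∀ F F' : L2C, eFourierSobolevNorm 9 F < ⊤ → eFourierSobolevNorm 9 F' < ⊤ →
      ‖L F - L F'‖ₑ = eFourierSobolevNorm 9 (F - F'))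
    (hLn : ∀ F : L2C, eFourierSobolevNorm 9 F < ⊤ → ‖L F‖ₑ = eFourierSobolevNorm 9 F)
    {P : ℝ → (L2C →L[ℂ] L2C)} (hPb : ∀ σ : ℝ, 0 < σ → ‖P σ‖ ≤ 1 + σ ^ (-(1 / 2 : ℝ)))
    (hP0 : ∀ σ : ℝ, σ ≤ 0 → P σ = 0)
    (hPf : ∀ ρ σ : ℝ, 0 < ρ → ρ ≤ σ → ∀ h : L2C, P σ h = heat (σ - ρ) (P ρ h))
    (hJPL : ∀ σ : ℝ, 0 < σ → ∀ F : L2C, eFourierSobolevNorm 9 F < ⊤ → J (P σ (L F)) = heat σ F)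
    {a ga : L2C} (ha : MemH10df a) (hJa : J ga = a) {R : ℝ} (hga : ‖ga‖ ≤ R)
    {M η τ : ℝ} (hM : 0 ≤ M) (hRM : R ≤ M) (hη1 : R + K * (M * M) * η ≤ M)
    (hη2 : 2 * K * M * η ≤ 1 / 2)
    (hβ : ∀ r ∈ Icc (0 : ℝ) τ, |∫ σ in (0 : ℝ)..r, (1 + σ ^ (-(1 / 2 : ℝ)))| ≤ η) (hτ : 0 ≤ τ) :
    ∃ g : ℝ → L2C, Continuous g ∧ (∀ t, ‖g t‖ ≤ M) ∧
      (∀ t, IsReal (J (g t)) ∧ IsFourierDivFree (J (g t))) ∧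
      ∀ t, g t = heat (max 0 (min t τ)) ga +
        ∫ s in (0 : ℝ)..max 0 (min t τ), P (max 0 (min t τ) - s) (L (Bop (J (g s)) (J (g s)))) := by
  -- the clamped clock
  have hc : ∀ t, max 0 (min t τ) ∈ Icc (0 : ℝ) τ := fun t =>
    ⟨le_max_left _ _, max_le hτ (min_le_right _ _)⟩
  have hcc : Continuous fun t : ℝ => max 0 (min t τ) :=
    continuous_const.max (continuous_id.min continuous_const)
  -- the lifted Duhamel map
  set Φ : (ℝ → L2C) → ℝ → L2C := fun g t => heat (max 0 (min t τ)) ga +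
    ∫ s in (0 : ℝ)..max 0 (min t τ), P (max 0 (min t τ) - s) (L (Bop (J (g s)) (J (g s))))
    with hΦ
  -- `Φ` preserves admissible curves
  have hstep : ∀ g : ℝ → L2C, Continuous g → (∀ t, ‖g t‖ ≤ M) →
      (∀ t, IsReal (J (g t)) ∧ IsFourierDivFree (J (g t))) →
      Continuous (Φ g) ∧ (∀ t, ‖Φ g t‖ ≤ M) ∧
        ∀ t, IsReal (J (Φ g t)) ∧ IsFourierDivFree (J (Φ g t)) := by
    intro g hg hgb hgr
    refine ⟨continuous_phi hK hB9 hBadd hJn hLsub hLn hPb hPf hM hg hgb hgr ga τ, fun t => ?_,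
      fun t => ?_⟩
    · exact (norm_phi_le hK hB9 hJn hLn hPb hM hgb hgr hga hβ (hc t)).trans hη1
    · exact j_phi_isReal_isFourierDivFree hK hB9 hBrd hBadd hJn hJh hLsub hLn hPb hP0 hPf hJPL hM
        hg hgb hgr hJa ha (hc t).1
  -- `Φ` halves distances between admissible curves
  have hcontr : ∀ g g' : ℝ → L2C, Continuous g → (∀ t, ‖g t‖ ≤ M) →
      (∀ t, IsReal (J (g t)) ∧ IsFourierDivFree (J (g t))) →
      Continuous g' → (∀ t, ‖g' t‖ ≤ M) →
      (∀ t, IsReal (J (g' t)) ∧ IsFourierDivFree (J (g' t))) →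
      ∀ δ : ℝ, 0 ≤ δ → (∀ s, ‖g s - g' s‖ ≤ δ) → ∀ t, ‖Φ g t - Φ g' t‖ ≤ δ / 2 := by
    intro g g' hg hgb hgr hg' hgb' hgr' δ hδ0 hδ t
    refine (norm_phi_sub_phi_le hK hB9 hBadd hJn hLsub hLn hPb hPf hM hg hgb hgr hg' hgb' hgr'
      hδ0 hδ ga hβ (hc t)).trans ?_
    calc 2 * K * M * η * δ ≤ 1 / 2 * δ := mul_le_mul_of_nonneg_right hη2 hδ0
      _ = δ / 2 := by ring
  -- the initial curve `g₀(t) = e^{rΔ} g_a`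
  set g0 : ℝ → L2C := fun t => heat (max 0 (min t τ)) ga with hg0
  have hg0adm : Continuous g0 ∧ (∀ t, ‖g0 t‖ ≤ M) ∧
      ∀ t, IsReal (J (g0 t)) ∧ IsFourierDivFree (J (g0 t)) := by
    refine ⟨continuous_heat₂.comp₂ hcc continuous_const,
      fun t => ((norm_heat_le _ _).trans hga).trans hRM, fun t => ?_⟩
    rw [hg0]
    dsimp only
    rw [hJh, hJa]
    exact ⟨ha.2.1.heat _, ha.2.2.heat _⟩
  -- the Picard sequence
  let gs : ℕ → ℝ → L2C := fun n => Nat.rec g0 (fun _ g => Φ g) n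
  have hgs : ∀ n, gs (n + 1) = Φ (gs n) := fun n => rfl
  have hadm : ∀ n, Continuous (gs n) ∧ (∀ t, ‖gs n t‖ ≤ M) ∧
      ∀ t, IsReal (J (gs n t)) ∧ IsFourierDivFree (J (gs n t)) := by
    intro n
    induction n with
    | zero => exact hg0adm
    | succ n ih =>
      rw [hgs]
      exact hstep _ ih.1 ih.2.1 ih.2.2
  -- geometric decay of consecutive differences
  have hdist : ∀ n t, dist (gs n t) (gs (n + 1) t) ≤ 4 * M / 2 / 2 ^ n := by
    intro n
    induction n with
    | zero =>
      intro t
      rw [dist_eq_norm, pow_zero, div_one]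
      calc ‖gs 0 t - gs 1 t‖ ≤ ‖gs 0 t‖ + ‖gs 1 t‖ := norm_sub_le _ _
        _ ≤ M + M := add_le_add ((hadm 0).2.1 t) ((hadm 1).2.1 t)
        _ = 4 * M / 2 := by ring
    | succ n ih =>
      intro t
      have h := hcontr (gs n) (gs (n + 1)) (hadm n).1 (hadm n).2.1 (hadm n).2.2 (hadm (n + 1)).1
        (hadm (n + 1)).2.1 (hadm (n + 1)).2.2 (4 * M / 2 / 2 ^ n) (by positivity)
        (fun s => by rw [← dist_eq_norm]; exact ih s) t
      rw [dist_eq_norm]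
      calc ‖gs (n + 1) t - gs (n + 1 + 1) t‖ = ‖Φ (gs n) t - Φ (gs (n + 1)) t‖ := rfl
        _ ≤ 4 * M / 2 / 2 ^ n / 2 := h
        _ = 4 * M / 2 / 2 ^ (n + 1) := by rw [pow_succ]; ring
  -- the pointwise limit
  have hcauchy : ∀ t, CauchySeq fun n => gs n t := fun t =>
    cauchySeq_of_le_geometric_two (fun n => hdist n t)
  choose glim hglim using fun t => cauchySeq_tendsto_of_complete (hcauchy t)
  have hrate : ∀ n t, dist (gs n t) (glim t) ≤ 4 * M / 2 ^ n := fun n t =>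
    dist_le_of_le_geometric_two_of_tendsto (fun n => hdist n t) (hglim t) n
  have hdecay : Tendsto (fun n : ℕ => 4 * M / 2 ^ n) atTop (𝓝 0) :=
    tendsto_const_nhds.div_atTop (tendsto_pow_atTop_atTop_of_one_lt one_lt_two)
  -- the limit is admissible
  have hglim_b : ∀ t, ‖glim t‖ ≤ M := fun t =>
    le_of_tendsto ((continuous_norm.tendsto _).comp (hglim t))
      (Eventually.of_forall fun n => (hadm n).2.1 t)
  have hglim_r : ∀ t, IsReal (J (glim t)) ∧ IsFourierDivFree (J (glim t)) := fun t =>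
    ⟨isClosed_setOf_isReal.mem_of_tendsto ((J.continuous.tendsto _).comp (hglim t))
        (Eventually.of_forall fun n => ((hadm n).2.2 t).1),
      B.isClosed_setOf_isFourierDivFree.mem_of_tendsto ((J.continuous.tendsto _).comp (hglim t))
        (Eventually.of_forall fun n => ((hadm n).2.2 t).2)⟩
  have hglim_c : Continuous glim := by
    refine TendstoUniformly.continuous (F := fun n => gs n) (p := atTop) ?_
      (Eventually.of_forall fun n => (hadm n).1).frequently
    rw [Metric.tendstoUniformly_iff]
    intro ε hε
    filter_upwards [hdecay.eventually (gt_mem_nhds hε)] with n hn t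
    rw [dist_comm]
    exact (hrate n t).trans_lt hn
  -- the limit is a fixed point
  have hfix : ∀ t, glim t = Φ glim t := by
    intro t
    refine tendsto_nhds_unique ((hglim t).comp (tendsto_add_atTop_nat 1)) ?_
    rw [tendsto_iff_norm_sub_tendsto_zero]
    have hb : ∀ n, ‖gs (n + 1) t - Φ glim t‖ ≤ 4 * M / 2 ^ n / 2 := fun n =>
      hcontr (gs n) glim (hadm n).1 (hadm n).2.1 (hadm n).2.2 hglim_c hglim_b hglim_r
        (4 * M / 2 ^ n) (by positivity) (fun s => by rw [← dist_eq_norm]; exact hrate n s) t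
    have ht : Tendsto (fun n : ℕ => 4 * M / 2 ^ n / 2) atTop (𝓝 0) := by
      simpa using hdecay.div_const 2
    exact squeeze_zero (fun n => norm_nonneg _) hb ht
  exact ⟨glim, hglim_c, hglim_b, hglim_r, hfix⟩

end E

open Literature.Analysis.FluidPDE Literature.Analysis.FluidPDE.Tao2016
open Literature.Analysis.FunctionSpaces (eFourierSobolevNorm)

/-- **Stub E (`localExistence`) of line `SketchIdeator2` — local existence of `H¹⁰_df`-mild
solutions, with lifespan uniform on `H¹⁰`-balls** (Tao 2016, §1.1 after (1.15): "the local
existence theory is standard"). For every averaging datum `𝒜` and every bilinear representative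
`Bop` of `𝒜.form` on `H¹⁰_df` that is real, divergence free, tame
(`‖Bop(u,v)‖_{H⁹} ≤ K‖u‖_{H¹⁰}‖v‖_{H¹⁰}`) and bilinear over `ℝ`, and every radius `R ≥ 0`, there
is a lifespan `τ = τ(K, R) > 0` such that every `a ∈ H¹⁰_df` with `‖a‖_{H¹⁰} ≤ R` has a mild
solution `u ∈ C([0,τ]; H¹⁰_df)` of `∂ₜu = Δu + B̃(u,u)`, `u(0) = a`, in Tao's duality sense
(1.15), with `‖u(t)‖_{H¹⁰} ≤ 2R + 1` on `[0, τ]`. -/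
theorem stub_localExistence :
    ∀ 𝒜 : AveragingDatum, ∀ (Bop : L2C → L2C → L2C) (K : ℝ),
      (0 ≤ K ∧
        (∀ u v : L2C, MemH10df u → MemH10df v →
          IsReal (Bop u v) ∧ IsFourierDivFree (Bop u v) ∧
          eFourierSobolevNorm 9 (Bop u v) ≤
            ENNReal.ofReal K * eFourierSobolevNorm 10 u * eFourierSobolevNorm 10 v ∧
          ∀ w : L2C, MemH10df w → pairing (Bop u v) w = 𝒜.form u v w) ∧
        (∀ u u' v : L2C, MemH10df u → MemH10df u' → MemH10df v →
          Bop (u + u') v = Bop u v + Bop u' v ∧ Bop v (u + u') = Bop v u + Bop v u') ∧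
        (∀ (c : ℝ) (u v : L2C), MemH10df u → MemH10df v →
          Bop ((c : ℂ) • u) v = (c : ℂ) • Bop u v ∧ Bop u ((c : ℂ) • v) = (c : ℂ) • Bop u v)) →
      ∀ R : ℝ, 0 ≤ R → ∃ τ : ℝ, 0 < τ ∧ ∀ a : L2C, MemH10df a →
        eFourierSobolevNorm 10 a ≤ ENNReal.ofReal R →
        ∃ u : ℝ → L2C, IsMildSolutionFor 𝒜.form a (Icc 0 τ) u ∧
          ∀ t ∈ Icc 0 τ, eFourierSobolevNorm 10 (u t) ≤ ENNReal.ofReal (2 * R + 1) := by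
  intro 𝒜 Bop K hBop R hR
  obtain ⟨hK, hB, hBadd, -⟩ := hBop
  have hB9 : ∀ u v : L2C, MemH10df u → MemH10df v → eFourierSobolevNorm 9 (Bop u v) ≤
      ENNReal.ofReal K * eFourierSobolevNorm 10 u * eFourierSobolevNorm 10 v :=
    fun u v hu hv => (hB u v hu hv).2.2.1
  have hBrd : ∀ u v : L2C, MemH10df u → MemH10df v →
      IsReal (Bop u v) ∧ IsFourierDivFree (Bop u v) :=
    fun u v hu hv => ⟨(hB u v hu hv).1, (hB u v hu hv).2.1⟩
  have hBform : ∀ u v : L2C, MemH10df u → MemH10df v → ∀ w : L2C, MemH10df w →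
      pairing (Bop u v) w = 𝒜.form u v w :=
    fun u v hu hv => (hB u v hu hv).2.2.2
  obtain ⟨J, P, L, hJn, hJh, hJonto, hLsub, hLn, hPb, hP0, hPf, hJPL⟩ := E.exists_ops
  -- constants: `M = 2R + 1`, `η = 1/(4KM² + 1)`
  set M : ℝ := 2 * R + 1 with hMdef
  have hM1 : 1 ≤ M := by rw [hMdef]; linarith
  have hM0 : 0 ≤ M := by linarith
  have hden : 0 < 4 * K * (M * M) + 1 := by positivity
  set η : ℝ := 1 / (4 * K * (M * M) + 1) with hηdef
  have hη0 : 0 < η := by rw [hηdef]; positivity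
  have hKη : K * (M * M) * η ≤ 1 / 4 := by
    rw [hηdef, mul_one_div, div_le_div_iff₀ hden (by norm_num : (0 : ℝ) < 4)]
    nlinarith
  have hη1 : R + K * (M * M) * η ≤ M := by rw [hMdef] at *; linarith
  have hη2 : 2 * K * M * η ≤ 1 / 2 := by
    have h : 2 * K * M * η ≤ 2 * (K * (M * M) * η) := by
      have h1 : 0 ≤ 2 * K * M * η * (M - 1) := by
        have : 0 ≤ M - 1 := by linarith
        positivity
      nlinarith
    linarith
  obtain ⟨τ, hτ, -, hβ⟩ := E.exists_clock_bound hη0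
  refine ⟨τ, hτ, fun a ha haR => ?_⟩
  -- the lifted datum `g_a`, `J g_a = a`, `‖g_a‖ = ‖a‖_{H¹⁰} ≤ R`
  obtain ⟨ga, hJa, hga'⟩ := hJonto a ha.1
  have hga : ‖ga‖ ≤ R := by
    have h : ‖ga‖ₑ ≤ ENNReal.ofReal R := hga'.trans_le haR
    rw [← ofReal_norm] at h
    exact (ENNReal.ofReal_le_ofReal_iff hR).1 h
  -- the fixed point of the lifted Duhamel map
  obtain ⟨g, hgc, hgb, hgr, hfix⟩ := E.exists_fixedPoint hK hB9 hBrd hBadd hJn hJh hLsub hLn hPb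
    hP0 hPf hJPL ha hJa hga hM0 (by linarith) hη1 hη2 hβ hτ.le
  refine ⟨fun t => J (g t), ⟨fun t _ => E.memH10df_j hJn (hgr t), ?_, ?_⟩, fun t _ => ?_⟩
  · -- continuity in `H¹⁰`: `‖J(g t) − J(g t₀)‖_{H¹⁰} = ‖g t − g t₀‖`
    intro t₀ _
    have h1 : (fun t => eFourierSobolevNorm 10 (J (g t) - J (g t₀))) = fun t => ‖g t - g t₀‖ₑ :=
      funext fun t => by rw [← map_sub, hJn]
    show Tendsto (fun t => eFourierSobolevNorm 10 (J (g t) - J (g t₀))) _ _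
    rw [h1]
    have h2 : Tendsto (fun t => ‖g t - g t₀‖ₑ) (𝓝 t₀) (𝓝 0) := by
      have hc : Continuous fun t => ‖g t - g t₀‖ₑ :=
        continuous_enorm.comp (hgc.sub continuous_const)
      simpa using hc.tendsto t₀
    exact h2.mono_left nhdsWithin_le_nhds
  · -- the Duhamel identity (1.15) in duality form
    intro t ht w hw
    have hct : max 0 (min t τ) = t := by rw [min_eq_left ht.2, max_eq_right ht.1]
    have hgt := hfix t
    rw [hct] at hgt
    have hI := E.intervalIntegrable_phi hK hB9 hBadd hJn hLsub hLn hPb hPf hM0 hgc hgb hgr ht.1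
    have hJg : J (g t) = heat t a +
        ∫ s in (0 : ℝ)..t, J (P (t - s) (L (Bop (J (g s)) (J (g s))))) := by
      rw [hgt]
      exact E.j_phi_eq hJh hI hJa
    have hI' : IntervalIntegrable (fun s => J (P (t - s) (L (Bop (J (g s)) (J (g s))))))
        volume 0 t :=
      ⟨J.integrable_comp hI.1, J.integrable_comp hI.2⟩
    -- the pairing with `w` commutes with the Bochner integral
    have hpair : pairing (∫ s in (0 : ℝ)..t, J (P (t - s) (L (Bop (J (g s)) (J (g s)))))) w =
        ∫ s in (0 : ℝ)..t, pairing (J (P (t - s) (L (Bop (J (g s)) (J (g s)))))) w := by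
      have hp : ∀ v : L2C, pairing v w = (innerSL ℂ (conjL2 w)) v := fun v => by
        rw [pairing_eq_inner_conjL2, innerSL_apply_apply]
      simp_rw [hp]
      exact ((innerSL ℂ (conjL2 w)).intervalIntegral_comp_comm hI').symm
    -- identification of the integrand off the endpoint `s = t`
    have hae : ∀ᵐ s ∂(volume : Measure ℝ), s ∈ Ι (0 : ℝ) t →
        pairing (J (P (t - s) (L (Bop (J (g s)) (J (g s)))))) w =
          𝒜.form (J (g s)) (J (g s)) (heat (t - s) w) := by
      have hne : ∀ᵐ s ∂(volume : Measure ℝ), s ≠ t := by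
        rw [ae_iff]
        simp
      filter_upwards [hne] with s hst hs
      rw [uIoc_of_le ht.1] at hs
      have hσ : 0 < t - s := sub_pos.2 (lt_of_le_of_ne hs.2 hst)
      have hu := E.memH10df_j hJn (hgr s)
      rw [hJPL _ hσ _ (E.bop_lt_top hB9 hu hu), pairing_heat_left, hBform _ _ hu hu _ (hw.heat _)]
    show pairing (J (g t)) w = pairing (heat t a) w +
      ∫ s in (0 : ℝ)..t, 𝒜.form (J (g s)) (J (g s)) (heat (t - s) w)
    rw [hJg, pairing_add_left, hpair, intervalIntegral.integral_congr_ae hae]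
  · -- the `H¹⁰` bound `‖u(t)‖_{H¹⁰} = ‖g(t)‖ ≤ 2R + 1`
    show eFourierSobolevNorm 10 (J (g t)) ≤ ENNReal.ofReal M
    rw [hJn, ← ofReal_norm]
    exact ENNReal.ofReal_le_ofReal (hgb t)

end Summit.NavierStokesRegularity.NavierStokesRegularity.Theorems.PerpetualPumpThesis
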